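import Summits.QuantumFields.BalabanUV.T4Continuum.Spine.NE1p.DressedAbsorptionWindow

/-!
# T⁴ programme, spine estimate NE1′ (node O3b/H2) — NON-VACUITY OF END-B THROUGH THE ABSORPTION DOOR (witness «W3» of the
# NE1′ formalisation swarm: a two-family tower with GENUINE absorption, booked by row S5's live-family supplier with the
# (w5b)-smallness discharged by row S5b's amplitude fixed point, ONE K-free `UniformConstants`, END-B ⟹ `DressedStability`)

Cell `pub-balaban`, sub-cell `t4`, BINDER-OWNERS row NE1′ (owner lineage t4-ne1p-p1); swarm unit `b2b-balaban-t4-ne1p-formalise-leaf-02`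
(INTENT journalled 2026-08-20T08:34:49Z); tree target `Summits/QuantumFields/BalabanUV/T4Continuum/Spine/NE1p/`; ADDITIVE — imports
`Spine/NE1p/DressedAbsorptionWindow` (p212827; ⊇ row S5 `DressedBirthSuppliers` p212423, row S3 `DressedUniformConstants` p212599,
the root `DressedRoot` p211416) ONLY, modifies nothing.

WHY.  `DressedRootWitness` (p211675) fires END-B through the HISTORY-FREE birth door only (one family per cutoff, the
`BirthGen` diagonal); W1∕W2 (leaf-03) inhabit END-F∕END-F′.  Nothing yet fires END-B through the (w5b) ABSORPTION door — births
by «budgets add», `AbsorbsFrom … (budgetGate …)` with a NON-EMPTY absorbed set and `A > 0` — with its fan-out smallness AND the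
(w6) source window holding for the SAME K-free `U`.  This file does, on a decided toy (nothing of Bałaban's is modelled):
* §1 DATA: at cutoff `K`, two families `Birth := Bool` — the OLD one (`false`, born at scale `0`, birth generation `1`) and the
  YOUNG one (`true`, born at scale `min 1 K`, birth generation `17∕16 = 1 + (1∕8)·(1∕2)` when `K ≥ 1`: its own dressing `β = 1`
  plus the absorption constant `A = 1∕8` times the old family's transported envelope `1∕2` at scale `1`); every generation is
  transported at rate `1∕2`, nothing regenerates; booked sizes = transported birth generations (positive).
* §2 THE LEAF BUNDLE at every cutoff with ONE `U = (C, A₀, ρ₁, τ, Λ, N₀, ρ′, s̄⁰, m) = (1, 2, 1∕2, 1, 1, 2, 1∕2, 1∕2, 1∕16)`: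
  `hbirth` by `DressedBirthSuppliers.hbirth_of_absorbsFrom_live` (absorbed ⊆ live older families, counted by the leaf's own
  `hcount`) with its `hsmall` DISCHARGED by `DressedAbsorptionWindow.absorbSmall_of_le` (`fanout (1∕8) 2 (1∕2) = 1∕2 < 1`,
  `absorbAmplitude 1 (1∕8) 2 (1∕2) = 2 ≤ A₀`); transport∕regeneration∕counts∕margins outright (a fortiori under the gate).
* §3 `dressedStability_absTower : DressedStability absTower` THROUGH END-B; `abs_genuine` (the young family's birth generation
  EXCEEDS its own dressing: the absorbed mass is really used); `not_birthGen_abs` (for `K ≥ 1` the history-free door with the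
  bare dressing amplitude `Â = 1` does NOT book this tower — the absorption door is exercised, not bypassed); `abs_size_pos`.

HONEST FRAMING.  [decided toy] + [folklore] bookkeeping; 0 sorry; 0 citations; NO `def … : Prop`; nothing of Bałaban's
densities, D-terms or renormalised components is modelled or asserted — the witness says only that END-B's binder family is
JOINTLY inhabitable through the absorption door with K-free constants.  NE1′ is NOT PRINTED and NOT PROVED («NE1′ ⇐ the named
binders»); the walls (w1), (w2-act) THE NUMBER, (w5), F-6's rate stand; 0 binders instantiated on Bałaban's densities; spine
PROVED 0∕9 unchanged.  Rung (B)+1 on ONE finite four-torus — NOT infinite volume, NOT a mass gap, NOT the Clay problem, NOT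
summit progress.  HONEST DEPENDENCY: continuum YM on T⁴ ⇐ BetaPertH ∧ nine spine estimates (0/9 proved); BetaPertH ⇐ (D1) ∧
(D4) ∧ CAP+tail; G-an2-4 gates asym, D1 and NE2/3/4.
-/

noncomputable section

namespace Summit.QuantumFields.BalabanUV.T4Continuum.NE1p.DressedAbsorptionWitness

open Finset
open scoped BigOperators
open Literature.MathematicalPhysics.QuantumFieldTheory.Balaban1983to89
open Literature.MathematicalPhysics.QuantumFieldTheory.Balaban1983to89.T4TermFormat
open Literature.MathematicalPhysics.QuantumFieldTheory.Balaban1983to89.T4TrajectoryComparison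
open Summit.QuantumFields.BalabanUV.T4Continuum.T4TrajectoryDensityDressed
open Summit.QuantumFields.BalabanUV.T4Continuum.NE1p.DressedRoot
open Summit.QuantumFields.BalabanUV.T4Continuum.NE1p.DressedBirthSuppliers
open Summit.QuantumFields.BalabanUV.T4Continuum.NE1p.DressedAbsorptionWindow

/-! ## §1 The two-family toy with genuine absorption -/

section Toy

/-- Birth scales [decided toy]: the old family (`false`) is born at `0`, the young one (`true`) at `min 1 K`. [folklore] -/
def bs (K : ℕ) (b : Bool) : ℕ := if b = true then min 1 K else 0

/-- Every family is born by the cutoff. [folklore] -/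
theorem bs_le (K : ℕ) (b : Bool) : bs K b ≤ K := by
  unfold bs; split_ifs <;> omega

/-- The old family is born at scale `0`. [folklore] -/
theorem bs_false (K : ℕ) : bs K false = 0 := by simp [bs]

/-- The young family is born at scale `1` once `K ≥ 1`. [folklore] -/
theorem bs_true {K : ℕ} (hK : 1 ≤ K) : bs K true = 1 := by simp [bs, Nat.min_eq_left hK]

/-- Birth generations [decided toy]: old family `1`; young family `17∕16` when it is genuinely younger (`K ≥ 1`), else `1`.
[folklore] -/
def g (K : ℕ) (b : Bool) : ℝ := if b = true ∧ 1 ≤ K then 17 / 16 else 1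

/-- Birth generations are positive. [folklore] -/
theorem g_pos (K : ℕ) (b : Bool) : 0 < g K b := by
  unfold g; split_ifs <;> norm_num

/-- Birth generations are at least the dressing size `1`. [folklore] -/
theorem one_le_g (K : ℕ) (b : Bool) : 1 ≤ g K b := by
  unfold g; split_ifs <;> norm_num

/-- Birth generations are at most `17∕16`. [folklore] -/
theorem g_le (K : ℕ) (b : Bool) : g K b ≤ 17 / 16 := by
  unfold g; split_ifs <;> norm_num

/-- TOY BOOKING at cutoff `K` [decided toy]: two observable-attached families (`Bool`), each its own localisation domain, felt at
one cube of every scale `≥` its birth scale, with POSITIVE booked size `g b·(1∕2)^{k−j_b}` at scale `k`. Nothing of Bałaban's is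
modelled. [folklore] -/
def absBooking (K : ℕ) : T4TermFormat.Booking where
  K := K
  Dom := Bool
  domScale := bs K
  treeLen := fun _ => 0
  treeLen_nonneg := fun _ => le_rfl
  balSize := fun _ => 0
  Birth := Bool
  births := Finset.univ
  mem_births := fun b => Finset.mem_univ b
  birthScale := bs K
  birth_le := bs_le K
  loc := id
  loc_scale := fun _ => rfl
  Cube := Fin (K + 1)
  cubes := Finset.univ
  mem_cubes := fun q => Finset.mem_univ q
  cubeScale := fun q => q.val
  cube_le := fun q => Nat.lt_succ_iff.mp q.isLt
  feltAt := fun q => Finset.univ.filter fun b => bs K b ≤ q.val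
  felt_birth_le := fun q b hb => (Finset.mem_filter.mp hb).2
  size := fun b k => g K b * (1 / 2 : ℝ) ^ (k - bs K b)
  size_nonneg := fun b k => by have := g_pos K b; positivity
  pair := fun _ _ _ => 0

/-- TOY TRAJECTORY [decided toy]: one generation per family (its birth), re-linearised size = transported birth generation at
rate `1∕2`. [folklore] -/
def absTrajectory (K : ℕ) : Trajectory (absBooking K) where
  lin := fun b k' k => if k' = bs K b then g K b * (1 / 2 : ℝ) ^ (k - bs K b) else 0
  lin_nonneg := fun b k' k => by have := g_pos K b; split_ifs <;> positivity
  gen := fun b k' => if k' = bs K b then g K b else 0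
  gen_nonneg := fun b k' => by have := g_pos K b; split_ifs <;> positivity
  size_le := fun b k hbk _ => by
    show g K b * (1 / 2 : ℝ) ^ (k - bs K b) ≤
      ∑ k' ∈ Icc (bs K b) k, (if k' = bs K b then g K b * (1 / 2 : ℝ) ^ (k - bs K b) else 0)
    rw [Finset.sum_ite_eq' (Icc (bs K b) k) (bs K b) (fun _ => g K b * (1 / 2 : ℝ) ^ (k - bs K b))]
    have hbk' : bs K b ≤ k := hbk
    rw [if_pos (Finset.mem_Icc.mpr ⟨le_rfl, hbk'⟩)]

/-- TOY TOWER [decided toy]: the two-family booking and trajectory at every cutoff (one run parameter). [folklore] -/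
def absTower : DressedTower Unit where
  B := fun _ K => absBooking K
  K_eq := fun _ _ => rfl
  T := fun _ K => absTrajectory K

/-- TOY CONSTANTS [decided toy]: `C = 1`, `A₀ = 2` (= the absorption fixed point `absorbAmplitude 1 (1∕8) 2 (1∕2)`), `ρ₁ = 1∕2`,
`τ = 1`, `Λ = 1`, `N₀ = 2`, `ρ′ = 1∕2` (`Λρ₁τ = 1∕2`), `s̄⁰ = 1∕2`, `m = 1∕16` (`m·N₀A₀(1−ρ′)⁻¹ = 1∕2 = 1 − s̄⁰`). [folklore] -/
def absConstants : UniformConstants where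
  C := 1
  A₀ := 2
  ρ₁ := 1 / 2
  τ := 1
  Λ := 1
  N₀ := 2
  ρ' := 1 / 2
  sbar := 1 / 2
  m := 1 / 16
  hC := zero_le_one
  hA₀ := by norm_num
  hρ₁ := by norm_num
  hτ0 := zero_le_one
  hτ1 := le_rfl
  hΛ := zero_le_one
  hN₀ := by norm_num
  hm := by norm_num
  hρ'1 := by norm_num
  hprod := by norm_num
  hsmall := by norm_num

/-- The absorbed set [decided toy]: the young family absorbs the old one when it is genuinely younger (`K ≥ 1`); nothing else is
absorbed. [folklore] -/
def Sabs (K : ℕ) (b : Bool) : Finset Bool := if b = true ∧ 1 ≤ K then {false} else ∅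

/-- The live families of a met component at scale `k` [decided toy]: every family born at a scale `≤ k`. [folklore] -/
def Slive (K k : ℕ) (_b : Bool) : Finset Bool := Finset.univ.filter fun f => bs K f ≤ k

/-- Absorbed families are STRICTLY OLDER (the `holder` binder of row S5). [folklore] -/
theorem holder_abs (K : ℕ) : ∀ b b₀ : Bool, b₀ ∈ Sabs K b → bs K b₀ < bs K b := by
  intro b b₀ h
  unfold Sabs at h
  split_ifs at h with hb
  · rw [Finset.mem_singleton] at h
    subst h
    rw [hb.1, bs_false, bs_true hb.2]
    exact Nat.zero_lt_one
  · simp at h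

/-- Absorbed families are among the live families at the birth scale (the `hsub` binder of row S5). [folklore] -/
theorem hsub_abs (K : ℕ) : ∀ b : Bool, Sabs K b ⊆ Slive K (bs K b) b := by
  intro b b₀ h
  have hlt := holder_abs K b b₀ h
  exact Finset.mem_filter.mpr ⟨Finset.mem_univ _, hlt.le⟩

/-- The live-family positional count with `N₀ = 2`, `Λ = 1` (the `hcount` field ∕ `hcountS` binder): at most two families.
[folklore] -/
theorem hcount_abs (K : ℕ) :
    ∀ k (b : Bool), ∀ j ≤ k, (((Slive K k b).filter fun f => bs K f = j).card : ℝ) ≤ 2 * (1 : ℝ) ^ (k - j) := by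
  intro k b j _
  rw [one_pow, mul_one]
  have h : ((Slive K k b).filter fun f => bs K f = j).card ≤ 2 :=
    (Finset.card_le_card (Finset.filter_subset _ _)).trans
      ((Finset.card_le_card (Finset.filter_subset _ _)).trans (by simp))
  exact_mod_cast h

/-- The transport-rate step product of the toy: `stepProd (fun _ => 1∕2) k′ k = (1∕2)^{k−k′}`. [arith] [folklore] -/
theorem stepProd_half (k' k : ℕ) : stepProd (fun _ => (1 / 2 : ℝ)) k' k = (1 / 2 : ℝ) ^ (k - k') :=
  stepProd_const _ _ _

/-- The old family's transported envelope at scale `1` is at least `1∕2` (its birth term alone; any cutoff). [arith] [folklore] -/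
theorem envVar_old_ge (K : ℕ) :
    (1 / 2 : ℝ) ≤ (absTrajectory K).envVar 1 (fun _ => (1 / 2 : ℝ)) false 1 := by
  unfold Trajectory.envVar
  have hbs : (absBooking K).birthScale false = 0 := bs_false K
  rw [hbs]
  have hmem : (0 : ℕ) ∈ Icc 0 1 := by simp
  have hterm : (1 : ℝ) * stepProd (fun _ => (1 / 2 : ℝ)) 0 1 * (absTrajectory K).gen false 0 = 1 / 2 := by
    rw [stepProd_half]
    show (1 : ℝ) * (1 / 2) ^ (1 - 0) * (if (0 : ℕ) = bs K false then g K false else 0) = 1 / 2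
    rw [bs_false, if_pos rfl]
    simp [g]
  have hnn : ∀ k' ∈ Icc 0 1, (0 : ℝ) ≤ (1 : ℝ) * stepProd (fun _ => (1 / 2 : ℝ)) k' 1 * (absTrajectory K).gen false k' :=
    fun k' _ => mul_nonneg (mul_nonneg zero_le_one (stepProd_nonneg (fun _ => by norm_num) _ _))
      ((absTrajectory K).gen_nonneg false k')
  calc (1 / 2 : ℝ) = (1 : ℝ) * stepProd (fun _ => (1 / 2 : ℝ)) 0 1 * (absTrajectory K).gen false 0 := hterm.symm
    _ ≤ ∑ k' ∈ Icc 0 1, (1 : ℝ) * stepProd (fun _ => (1 / 2 : ℝ)) k' 1 * (absTrajectory K).gen false k' :=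
        Finset.single_le_sum (f := fun k' => (1 : ℝ) * stepProd (fun _ => (1 / 2 : ℝ)) k' 1 * (absTrajectory K).gen false k')
          hnn hmem

/-- **GENUINE ABSORPTION UNDER THE DRESSED GATE** [decided toy]: `AbsorbsFrom 1 (1∕2) (β ≡ 1) (A = 1∕8) Sabs Gate` for ANY gate —
the young family's birth generation `17∕16` is its dressing `1` plus `1∕8` of the old family's envelope `≥ 1∕2`. [folklore] -/
theorem absorbsFrom_abs (K : ℕ) (Gate : ℕ → Prop) :
    (absTrajectory K).AbsorbsFrom 1 (fun _ => (1 / 2 : ℝ)) (fun _ => 1) (1 / 8) (Sabs K) Gate := by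
  intro b _ _
  show (1 : ℝ) * (if bs K b = bs K b then g K b else 0) ≤
    1 + 1 / 8 * ∑ b₀ ∈ Sabs K b, (absTrajectory K).envVar 1 (fun _ => (1 / 2 : ℝ)) b₀ (bs K b)
  rw [if_pos rfl, one_mul]
  unfold Sabs
  split_ifs with hb
  · rw [Finset.sum_singleton, hb.1, bs_true hb.2]
    have h := envVar_old_ge K
    have hg : g K true = 17 / 16 := by simp [g, hb.2]
    rw [hg]
    linarith
  · rw [Finset.sum_empty, mul_zero, add_zero]
    unfold g
    rw [if_neg hb]

end Toy

/-! ## §2 The leaf bundle at every cutoff, `hbirth` through the absorption door -/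

/-- TOY LEAVES [decided toy]: at every cutoff the leaf binders hold with `absConstants` — rates `1∕2`, no regeneration, action
margin `0`, live families = all born families; `hbirth` by row S5's `hbirth_of_absorbsFrom_live` with the (w5b)-smallness from
row S5b's `absorbSmall_of_le` (`fanout = 1∕2`, fixed point `2 = A₀`); transport and regeneration hold outright. [folklore] -/
def absLeaves (K : ℕ) : BookingLeaves absConstants (absBooking K) (absTrajectory K) where
  ρ := fun _ => 1 / 2
  c := fun _ => 0
  s₀ := fun _ _ => 0
  S := Slive K
  hρ := fun _ => by norm_num
  hc := fun _ => le_rfl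
  hrate := fun _ _ => by
    show (1 / 2 : ℝ) + 1 * 0 ≤ 1 / 2
    norm_num
  hS := fun k b f hf => (Finset.mem_filter.mp hf).2
  hcount := hcount_abs K
  hs₀ := fun _ _ => by
    show (0 : ℝ) ≤ 1 / 2
    norm_num
  hbirth :=
    hbirth_of_absorbsFrom_live absConstants (absTrajectory K) (fun _ => 1 / 2) (fun _ _ => 0) (Slive K)
      (β := fun _ => 1) (A := 1 / 8) (β₀ := 1) (holder_abs K) (hsub_abs K) (hcount_abs K) (by norm_num)
      (absorbsFrom_abs K _) (fun j _ => by show (1 : ℝ) ≤ 1 * 1 ^ ((absBooking K).K - j); simp)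
      (absorbSmall_of_le (β₀ := 1) (A := 1 / 8) (N₀ := 2) (A₀ := 2) (ρ' := 1 / 2)
        (by norm_num [fanout]) (by norm_num [absorbAmplitude, fanout]))
  htr := fun b k' k _ _ _ _ => by
    show (if k' = bs K b then g K b * (1 / 2 : ℝ) ^ (k - bs K b) else 0) ≤
      1 * stepProd (fun _ => (1 / 2 : ℝ)) k' k * (if k' = bs K b then g K b else 0)
    by_cases h : k' = bs K b
    · subst h
      rw [if_pos rfl, if_pos rfl, stepProd_half]
      linarith
    · rw [if_neg h, if_neg h]
      simp
  hreg := fun b k hbk _ _ => by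
    show (if k + 1 = bs K b then g K b else 0) ≤ 0 * (g K b * (1 / 2 : ℝ) ^ (k - bs K b))
    have hne : k + 1 ≠ bs K b := by
      have : bs K b ≤ k := hbk
      omega
    rw [if_neg hne]
    simp

/-! ## §3 The root through END-B; the absorption is genuine and the history-free door does not book the tower -/

/-- **NON-VACUITY OF END-B THROUGH THE ABSORPTION DOOR** [decided toy]: the two-family tower has `DressedStability` — from
`dressedStability_of_bookingLeaves` with ONE `UniformConstants` serving every cutoff, the birth leaf supplied by
`hbirth_of_absorbsFrom_live` ∘ `absorbSmall_of_le`. [folklore] -/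
theorem dressedStability_absTower : DressedStability absTower :=
  dressedStability_of_bookingLeaves absConstants absTower fun _ K => absLeaves K

/-- … with the constants displayed: class `2·(1∕2)^{k−j}·1^{K−j}` at every cutoff. [folklore] -/
theorem dressedStabilityWith_absTower : DressedStabilityWith absTower 2 (1 / 2) 1 :=
  dressedStabilityWith_of_bookingLeaves absConstants absTower fun _ K => absLeaves K

/-- **THE ABSORPTION IS GENUINE** [decided toy]: for `K ≥ 1` the young family's birth generation (`17∕16`) strictly EXCEEDS its
own dressing size (`β = 1`) — the absorbed old envelope is really spent. [folklore] -/
theorem abs_genuine {K : ℕ} (hK : 1 ≤ K) : (1 : ℝ) < (absTrajectory K).gen true (bs K true) := by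
  show (1 : ℝ) < if bs K true = bs K true then g K true else 0
  rw [if_pos rfl]
  simp [g, hK]
  norm_num

/-- **THE HISTORY-FREE DOOR DOES NOT BOOK THIS TOWER** [decided toy]: for `K ≥ 1`, `BirthGen Â τ` with the bare dressing
amplitude `Â = 1` (and `τ = 1`) FAILS — so `dressedStability_absTower` exercises the absorption door, not a disguised
`BirthGen` diagonal. [folklore] -/
theorem not_birthGen_abs {K : ℕ} (hK : 1 ≤ K) : ¬ (absTrajectory K).BirthGen 1 1 := by
  intro h
  have h1 : (absTrajectory K).gen true (bs K true) ≤ 1 * 1 ^ ((absBooking K).K - bs K true) := h true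
  have h2 := abs_genuine hK
  rw [one_pow, mul_one] at h1
  exact absurd h1 (not_le.mpr h2)

/-- The toy is non-degenerate: every booked size is positive at every cutoff and scale. [folklore] -/
theorem abs_size_pos (K k : ℕ) (b : (absBooking K).Birth) : 0 < (absBooking K).size b k := by
  show (0 : ℝ) < g K b * (1 / 2 : ℝ) ^ (k - bs K b)
  have := g_pos K b
  positivity

/-- The absorbed set is non-empty for the young family (`K ≥ 1`): one older family is absorbed. [folklore] -/
theorem sabs_nonempty {K : ℕ} (hK : 1 ≤ K) : (Sabs K true).Nonempty := by
  simp [Sabs, hK]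

end Summit.QuantumFields.BalabanUV.T4Continuum.NE1p.DressedAbsorptionWitness

end
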